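import Literature.NumberTheory.Transcendental.NesterenkoGenericSplitting
import Literature.RingTheory.Localization.DerivationFractionField
import Literature.FieldTheory.Separability.DerivationAlgebraic
import Mathlib.Algebra.MvPolynomial.PDeriv
import Mathlib.Algebra.MvPolynomial.Derivation
import Mathlib.RingTheory.Derivation.Lie
import HarnessLib

/-!
# Derivatives of the generic section point with respect to the generic hyperplanes ([Nes3] Lemma 1)

`Literature/NumberTheory/Transcendental/NesterenkoGenericPointDerivatives.lean`. Let
`𝒢 : GSec m` be a homogeneous prime `𝔭 ⊂ ℚ[x₀, …, x_m]` of rank `s + 1` with chart `x_j ∉ 𝔭`,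
`A = ℚ[U']` (`U' = (u_{lk})`, `s` groups), `K' = ℚ(U')`, and `ρ ∈ 𝕃₀ = K'(ρ) ⊂ 𝕃` the generic
section point (`NesterenkoGenericSectionField.lean`, `NesterenkoGenericSplitting.lean`): `ρ_j = 1`,
`∑ₖ u_{lk} ρₖ = 0`, `R(ρ) = 0 ⟺ R ∈ 𝔭` for forms `R`. This file differentiates `ρ` with respect
to the `u_{lk}`:

* `dK c` (`c = (l, k)`) — the partial derivative `∂/∂u_{lk}` on `K'` (the polynomial partial
  derivative extended to the field of fractions), `dL c` — its unique extension to the finite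
  separable extension `𝕃₀/K'`; the `dK c` commute, hence so do the `dL c` (`dL_comm`);
* **`dL_rho_eq` (Nesterenko's Lemma 1)**: for `q ≠ j` and every `k`,
  `∂ρₖ/∂u_{pq} = ρ_q · ∂ρₖ/∂u_{pj}`.

PROOF OF LEMMA 1 (a coordinate-free form of [Nes3, Lemma 1] = Zhu, App. 3, Lemma 1). The tree
realises `𝕃` as `Frac(ℚ(𝔭)[X_{lk}])` with `u_{lk} ↦ X_{lk}` (`k ≠ j`) and
`u_{lj} ↦ −∑_{k ≠ j} (x̄ₖ/x̄ⱼ) X_{lk}` (the pivot presentation), and `ρₖ = x̄ₖ/x̄ⱼ ∈ ℚ(𝔭)`. The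
`ℚ(𝔭)`-linear partial derivative `Δ_{pq} = ∂/∂X_{pq}` of `𝕃` kills `ρ`, and on `K'` it restricts
to `∂/∂u_{pq} − ρ_q ∂/∂u_{pj}` (check on the variables `u_{lk}`). By uniqueness of extensions of
derivations along the separable extension `𝕃₀/K'`, the derivation
`∂̃_{pq} − ρ_q ∂̃_{pj} : 𝕃₀ → 𝕃` coincides with `Δ_{pq}|𝕃₀`, so it kills `ρ`. (Nesterenko argues
instead with a non-singular Jacobian-type matrix built from a transcendence basis; the statement
is the same.)

## References

* [Nes3] Yu. V. Nesterenko, *Estimates for the characteristic function of a prime ideal*,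
  Mat. Sb. 123 (165) (1984) 11–34 = Math. USSR Sb. 51 (1985), Lemma 1.
* [NesterenkoPhilippon2001] LNM 1752, Ch. 10 Lemma 3.1 (p. 153) (where [Nes3] is invoked).
-/

noncomputable section

open MvPolynomial

namespace Literature.NumberTheory.Transcendental

namespace Nesterenko

namespace GSec

variable {m : ℕ} (𝒢 : GSec m)

/-! ### Pinning the integer structures

`K'` and `𝕃` are fields of fractions (`FractionRing`), on which Mathlib offers two `ℤ`-algebra
structures (the localisation of the `ℤ`-algebra structure of the numerator ring, and
`Ring.toIntAlgebra`); we pin the latter, whose module structure is the additive-group one used by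
`Derivation ℤ`. -/

/-- Short-cut instance (see the section docstring). [folklore] -/
instance (priority := 10000) intAlgebraKp : Algebra ℤ 𝒢.Kp := Ring.toIntAlgebra _

/-- Short-cut instance (see the section docstring). [folklore] -/
instance (priority := 10000) intAlgebraLL : Algebra ℤ 𝒢.LL := Ring.toIntAlgebra _

/-- Short-cut instance (see the section docstring). [folklore] -/
instance (priority := 10000) intAlgebraL0 : Algebra ℤ 𝒢.L0 := Ring.toIntAlgebra _

/-- A `ℤ`-derivation of a division ring of characteristic zero into a torsion-free group kills the
rational constants (`den • D(a) = D(num • 1) = 0`). [folklore] -/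
theorem derivation_ratCast {A M : Type*} [Field A] [CharZero A] [AddCommGroup M] [Module A M]
    [NoZeroSMulDivisors ℤ M] (D : Derivation ℤ A M) (a : ℚ) : D (a : A) = 0 := by
  have hden : (a.den : ℤ) ≠ 0 := by exact_mod_cast a.den_ne_zero
  have hA : ((a.den : ℤ) : A) * (a : A) = ((a.num : ℤ) : A) := by
    have h := Rat.mul_den_eq_num a
    have h' : ((a * a.den : ℚ) : A) = ((a.num : ℚ) : A) := by rw [h]
    push_cast at h'
    rw [Int.cast_natCast, mul_comm]
    exact h'
  have h1 : (a.den : ℤ) • D (a : A) = 0 := by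
    rw [← map_zsmul, zsmul_eq_mul, hA, show ((a.num : ℤ) : A) = (a.num : ℤ) • (1 : A) by
      rw [zsmul_eq_mul, mul_one], map_zsmul, D.map_one_eq_zero, smul_zero]
  exact (smul_eq_zero.mp h1).resolve_left hden

/-! ### Partial derivatives on `K' = ℚ(U')` -/

/-- `∂/∂u_c` on `A = ℚ[U']` with values in `K'` (as a `ℤ`-derivation). [folklore] -/
def dA (c : Fin 𝒢.s × Fin (m + 1)) : Derivation ℤ (RU 𝒢.s m) 𝒢.Kp :=
  (Algebra.linearMap (RU 𝒢.s m) 𝒢.Kp).compDer ((pderiv c).restrictScalars ℤ)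

/-- `dA` unfolded. [folklore] -/
theorem dA_apply (c : Fin 𝒢.s × Fin (m + 1)) (G : RU 𝒢.s m) :
    𝒢.dA c G = algebraMap (RU 𝒢.s m) 𝒢.Kp (pderiv c G) := rfl

/-- **`∂/∂u_c` on `K' = ℚ(U')`** (the quotient rule). [folklore] -/
def dK (c : Fin 𝒢.s × Fin (m + 1)) : Derivation ℤ 𝒢.Kp 𝒢.Kp :=
  (𝒢.dA c).fractionFieldExtend (F := 𝒢.Kp)

/-- `∂/∂u_c` of a polynomial is its partial derivative. [folklore] -/
@[simp] theorem dK_algebraMap (c : Fin 𝒢.s × Fin (m + 1)) (G : RU 𝒢.s m) :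
    𝒢.dK c (algebraMap (RU 𝒢.s m) 𝒢.Kp G) = algebraMap (RU 𝒢.s m) 𝒢.Kp (pderiv c G) := by
  rw [dK, Derivation.fractionFieldExtend_algebraMap, dA_apply]

/-- Partial derivatives of polynomials commute. [folklore] -/
theorem pderiv_comm {σ R : Type*} [CommRing R] (c c' : σ) (P : MvPolynomial σ R) :
    pderiv c (pderiv c' P) = pderiv c' (pderiv c P) := by
  classical
  have h : (⁅pderiv (R := R) c, pderiv c'⁆ : Derivation R (MvPolynomial σ R) (MvPolynomial σ R)) = 0 := by
    refine MvPolynomial.derivation_ext fun i => ?_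
    simp [Derivation.commutator_apply, pderiv_X, Pi.single_apply, apply_ite]
  have := congrArg (fun D : Derivation R (MvPolynomial σ R) (MvPolynomial σ R) => D P) h
  simpa [Derivation.commutator_apply, sub_eq_zero] using this

/-- **The `∂/∂u_c` commute on `K'`.** [folklore] -/
theorem lie_dK (c c' : Fin 𝒢.s × Fin (m + 1)) : ⁅𝒢.dK c, 𝒢.dK c'⁆ = 0 := by
  refine Derivation.eq_zero_of_forall_algebraMap (A := RU 𝒢.s m) _ fun G => ?_
  rw [Derivation.commutator_apply, dK_algebraMap, dK_algebraMap, dK_algebraMap, dK_algebraMap,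
    pderiv_comm, sub_self]

/-- The `∂/∂u_c` commute on `K'` (pointwise). [folklore] -/
theorem dK_comm (c c' : Fin 𝒢.s × Fin (m + 1)) (x : 𝒢.Kp) :
    𝒢.dK c (𝒢.dK c' x) = 𝒢.dK c' (𝒢.dK c x) := by
  have := congrArg (fun D : Derivation ℤ 𝒢.Kp 𝒢.Kp => D x) (𝒢.lie_dK c c')
  simpa [Derivation.commutator_apply, sub_eq_zero] using this

/-! ### Their extensions to `𝕃₀ = K'(ρ)` -/

/-- **`∂̃_c`: the unique extension of `∂/∂u_c` to the finite separable extension `𝕃₀/K'`.**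
[cite: NesterenkoPhilippon2001, Ch. 10 §3 (p. 153), via [Nes3]] -/
def dL (c : Fin 𝒢.s × Fin (m + 1)) : Derivation ℤ 𝒢.L0 𝒢.L0 :=
  (𝒢.dK c).extendFinite (E := 𝒢.L0)

/-- `∂̃_c` extends `∂/∂u_c`. [folklore] -/
@[simp] theorem dL_algebraMap (c : Fin 𝒢.s × Fin (m + 1)) (x : 𝒢.Kp) :
    𝒢.dL c (algebraMap 𝒢.Kp 𝒢.L0 x) = algebraMap 𝒢.Kp 𝒢.L0 (𝒢.dK c x) := by
  rw [dL, Derivation.extendFinite_algebraMap]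

/-- **The `∂̃_c` commute.** [folklore] -/
theorem dL_comm (c c' : Fin 𝒢.s × Fin (m + 1)) (y : 𝒢.L0) :
    𝒢.dL c (𝒢.dL c' y) = 𝒢.dL c' (𝒢.dL c y) :=
  Derivation.extendFinite_comm (𝒢.lie_dK c c') y

/-! ### The `ℚ(𝔭)`-linear partial derivatives `Δ_c = ∂/∂X_c` of `𝕃 = Frac(ℚ(𝔭)[X])` -/

/-- `∂/∂X_c` on `ℚ(𝔭)[X]` with values in `𝕃`. [folklore] -/
def ΔA (c : Fin 𝒢.s × Fin (m + 1)) : Derivation 𝒢.Lp 𝒢.RUL 𝒢.LL :=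
  (Algebra.linearMap 𝒢.RUL 𝒢.LL).compDer (pderiv c)

/-- **`Δ_c = ∂/∂X_c` on `𝕃`**, a `ℚ(𝔭)`-linear derivation. [folklore] -/
def Δ (c : Fin 𝒢.s × Fin (m + 1)) : Derivation 𝒢.Lp 𝒢.LL 𝒢.LL :=
  (𝒢.ΔA c).fractionFieldExtend (F := 𝒢.LL)

/-- `Δ_c` of a polynomial. [folklore] -/
@[simp] theorem Δ_algebraMap (c : Fin 𝒢.s × Fin (m + 1)) (P : 𝒢.RUL) :
    𝒢.Δ c (algebraMap 𝒢.RUL 𝒢.LL P) = algebraMap 𝒢.RUL 𝒢.LL (pderiv c P) := by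
  rw [Δ, Derivation.fractionFieldExtend_algebraMap]; rfl

/-- `Δ_c` kills `ℚ(𝔭)`. [folklore] -/
@[simp] theorem Δ_algebraMap_Lp (c : Fin 𝒢.s × Fin (m + 1)) (a : 𝒢.Lp) :
    𝒢.Δ c (algebraMap 𝒢.Lp 𝒢.LL a) = 0 :=
  (𝒢.Δ c).map_algebraMap a

/-- **`Δ_c` kills the generic section point** (`ρₖ ∈ ℚ(𝔭)`). [folklore] -/
@[simp] theorem Δ_rho (c : Fin 𝒢.s × Fin (m + 1)) (k : Fin (m + 1)) : 𝒢.Δ c (𝒢.rho k) = 0 :=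
  𝒢.Δ_algebraMap_Lp c _

/-- `∂/∂X_{pq}` of `Φⱼ(u_{lk})`, `k ≠ j`: the Kronecker delta. [folklore] -/
theorem pderiv_pivotMap_X_of_ne (p : Fin 𝒢.s) (q : Fin (m + 1)) (l : Fin 𝒢.s) {k : Fin (m + 1)}
    (hk : k ≠ 𝒢.j) :
    pderiv (p, q) (𝒢.toRUL (X (l, k))) = if (p, q) = (l, k) then 1 else 0 := by
  classical
  rw [toRUL_X, NesterenkoK.pivotMap_X_inl_of_ne _ _ hk, pderiv_X]
  simp only [Pi.single_apply]
  split_ifs with h1 h2 h2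
  · rfl
  · exact absurd h1.symm h2
  · exact absurd h2.symm h1
  · rfl

/-- `∂/∂X_{pq}` (`q ≠ j`) of `Φⱼ(u_{lj}) = −(∑_{k ≠ j} X_{lk} x̄ₖ) x̄ⱼ⁻¹`: `−δ_{pl} x̄_q x̄ⱼ⁻¹`.
[folklore] -/
theorem pderiv_pivotMap_X_self (p : Fin 𝒢.s) {q : Fin (m + 1)} (hq : q ≠ 𝒢.j) (l : Fin 𝒢.s) :
    pderiv (p, q) (𝒢.toRUL (X (l, 𝒢.j))) =
      if p = l then -(C (NesterenkoK.xbar 𝒢.𝔭 q) * C (NesterenkoK.xbar 𝒢.𝔭 𝒢.j)⁻¹) else 0 := by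
  classical
  rw [toRUL_X, NesterenkoK.pivotMap_X_inl_self, pderiv_mul, pderiv_C, mul_zero, add_zero,
    map_neg, map_sum]
  have hsum : ∑ k ∈ Finset.univ.erase 𝒢.j, pderiv (p, q) (X (l, k) * C (NesterenkoK.xbar 𝒢.𝔭 k))
      = if p = l then C (NesterenkoK.xbar 𝒢.𝔭 q) else 0 := by
    simp only [pderiv_mul, pderiv_C, mul_zero, add_zero, pderiv_X]
    rw [Finset.sum_eq_single_of_mem q (Finset.mem_erase.mpr ⟨hq, Finset.mem_univ q⟩)]
    · by_cases hpl : p = l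
      · subst hpl; simp
      · simp [hpl, Prod.ext_iff, Ne.symm hpl]
    · intro k _ hkq
      simp [Prod.ext_iff, Ne.symm hkq]
  rw [hsum]
  split_ifs
  · first | rfl | ring
  · rw [neg_zero, zero_mul]

/-- `Δ_{pq}` on `u_{lk}`, `k ≠ j`. [folklore] -/
theorem Δ_algebraMap_X_of_ne (p : Fin 𝒢.s) (q : Fin (m + 1)) (l : Fin 𝒢.s) {k : Fin (m + 1)}
    (hk : k ≠ 𝒢.j) :
    𝒢.Δ (p, q) (algebraMap (RU 𝒢.s m) 𝒢.LL (X (l, k))) = if (p, q) = (l, k) then 1 else 0 := by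
  rw [algebraMap_A_apply, Δ_algebraMap, pderiv_pivotMap_X_of_ne 𝒢 p q l hk]
  split_ifs <;> simp

/-- `Δ_{pq}` (`q ≠ j`) on `u_{lj}`: `−ρ_q δ_{pl}`. [folklore] -/
theorem Δ_algebraMap_X_self (p : Fin 𝒢.s) {q : Fin (m + 1)} (hq : q ≠ 𝒢.j) (l : Fin 𝒢.s) :
    𝒢.Δ (p, q) (algebraMap (RU 𝒢.s m) 𝒢.LL (X (l, 𝒢.j))) = if p = l then -𝒢.rho q else 0 := by
  rw [algebraMap_A_apply, Δ_algebraMap, pderiv_pivotMap_X_self 𝒢 p hq l]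
  split_ifs with hpl
  · rw [map_neg, map_mul, rho, mul_comm ((𝒢.xb 𝒢.j)⁻¹), map_mul, algebraMap_Lp_eq, algebraMap_Lp_eq]
  · rw [map_zero]

/-- `Δ_{pq}` (`q ≠ j`) on every variable `u_{lk}` equals `∂/∂u_{pq} − ρ_q ∂/∂u_{pj}` there.
[folklore] -/
theorem Δ_algebraMap_X (p : Fin 𝒢.s) {q : Fin (m + 1)} (hq : q ≠ 𝒢.j) (l : Fin 𝒢.s)
    (k : Fin (m + 1)) :
    𝒢.Δ (p, q) (algebraMap (RU 𝒢.s m) 𝒢.LL (X (l, k))) =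
      algebraMap (RU 𝒢.s m) 𝒢.LL (pderiv (p, q) (X (l, k))) -
        𝒢.rho q * algebraMap (RU 𝒢.s m) 𝒢.LL (pderiv (p, 𝒢.j) (X (l, k))) := by
  classical
  rw [pderiv_X, pderiv_X, Pi.single_apply, Pi.single_apply]
  by_cases hk : k = 𝒢.j
  · subst hk
    rw [Δ_algebraMap_X_self 𝒢 p hq l,
      if_neg (show ¬((l, 𝒢.j) = (p, q)) from fun h => hq (Prod.ext_iff.mp h).2.symm), map_zero,
      zero_sub]
    by_cases hpl : p = l
    · subst hpl; rw [if_pos rfl, if_pos rfl, map_one, mul_one]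
    · rw [if_neg hpl, if_neg (show ¬((l, 𝒢.j) = (p, 𝒢.j)) from fun h => hpl (Prod.ext_iff.mp h).1.symm),
        map_zero, mul_zero, neg_zero]
  · rw [Δ_algebraMap_X_of_ne 𝒢 p q l hk,
      if_neg (show ¬((l, k) = (p, 𝒢.j)) from fun h => hk (Prod.ext_iff.mp h).2), map_zero,
      mul_zero, sub_zero]
    by_cases h1 : (p, q) = (l, k)
    · rw [if_pos h1, if_pos h1.symm, map_one]
    · rw [if_neg h1, if_neg (show ¬((l, k) = (p, q)) from fun h => h1 h.symm), map_zero]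

/-- A derivation `K' → 𝕃` minus `ρ_q` times another one, as a derivation (by hand).
[folklore] -/
def twist (D₁ D₂ : Derivation ℤ 𝒢.Kp 𝒢.Kp) (q : Fin (m + 1)) : Derivation ℤ 𝒢.Kp 𝒢.LL where
  toLinearMap := (Algebra.linearMap 𝒢.Kp 𝒢.LL).toAddMonoidHom.toIntLinearMap ∘ₗ D₁.toLinearMap -
    (LinearMap.mulLeft ℤ (𝒢.rho q)) ∘ₗ
      ((Algebra.linearMap 𝒢.Kp 𝒢.LL).toAddMonoidHom.toIntLinearMap ∘ₗ D₂.toLinearMap)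
  map_one_eq_zero' := by simp
  leibniz' x y := by
    simp only [LinearMap.sub_apply, LinearMap.coe_comp, Function.comp_apply,
      AddMonoidHom.coe_toIntLinearMap, LinearMap.toAddMonoidHom_coe, Derivation.coeFn_coe,
      Derivation.leibniz, map_add, Algebra.linearMap_apply, LinearMap.mulLeft_apply, smul_eq_mul,
      Algebra.smul_def, map_mul]
    ring

/-- `twist` unfolded. [folklore] -/
theorem twist_apply (D₁ D₂ : Derivation ℤ 𝒢.Kp 𝒢.Kp) (q : Fin (m + 1)) (x : 𝒢.Kp) :
    𝒢.twist D₁ D₂ q x = algebraMap 𝒢.Kp 𝒢.LL (D₁ x) - 𝒢.rho q * algebraMap 𝒢.Kp 𝒢.LL (D₂ x) :=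
  rfl

/-- **`Δ_{pq}` restricted to `K'` is `∂/∂u_{pq} − ρ_q ∂/∂u_{pj}`** (`q ≠ j`): both are derivations of
`K' = Frac(A)` into `𝕃` agreeing on `A` (compare on monomials). [folklore] -/
theorem Δ_algebraMap_Kp (p : Fin 𝒢.s) {q : Fin (m + 1)} (hq : q ≠ 𝒢.j) (x : 𝒢.Kp) :
    𝒢.Δ (p, q) (algebraMap 𝒢.Kp 𝒢.LL x) =
      algebraMap 𝒢.Kp 𝒢.LL (𝒢.dK (p, q) x) - 𝒢.rho q * algebraMap 𝒢.Kp 𝒢.LL (𝒢.dK (p, 𝒢.j) x) := by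
  classical
  let D₁ : Derivation ℤ 𝒢.Kp 𝒢.LL := ((𝒢.Δ (p, q)).restrictScalars ℤ).compAlgebraMap 𝒢.Kp
  have hD₁ : ∀ y, D₁ y = 𝒢.Δ (p, q) (algebraMap 𝒢.Kp 𝒢.LL y) := fun y => rfl
  suffices h : D₁ = 𝒢.twist (𝒢.dK (p, q)) (𝒢.dK (p, 𝒢.j)) q by
    rw [← hD₁, h, twist_apply]
  refine Derivation.eq_of_eqOn_algebraMap (A := RU 𝒢.s m) fun G => ?_
  rw [hD₁, twist_apply, dK_algebraMap, dK_algebraMap, ← IsScalarTower.algebraMap_apply,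
    ← IsScalarTower.algebraMap_apply, ← IsScalarTower.algebraMap_apply]
  -- both sides are derivations of `A = ℚ[U']` into `𝕃`; compare on monomials
  induction G using MvPolynomial.induction_on with
  | C a =>
    simp only [pderiv_C, map_zero, mul_zero, sub_zero]
    rw [show algebraMap (RU 𝒢.s m) 𝒢.LL (C a) = algebraMap 𝒢.RUL 𝒢.LL (C (algebraMap ℚ 𝒢.Lp a)) by
        rw [algebraMap_A_apply, toRUL_apply, rename_C, ← MvPolynomial.algebraMap_eq,
          AlgHom.commutes, IsScalarTower.algebraMap_apply ℚ 𝒢.Lp 𝒢.RUL, MvPolynomial.algebraMap_eq],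
      ← algebraMap_Lp_eq, Δ_algebraMap_Lp]
  | add P Q hP hQ =>
    rw [map_add, map_add, map_add, map_add, map_add, map_add, hP, hQ]; ring
  | mul_X P lk hP =>
    obtain ⟨l, k⟩ := lk
    rw [map_mul, (𝒢.Δ _).leibniz, hP, Δ_algebraMap_X 𝒢 p hq l k, pderiv_mul, pderiv_mul]
    simp only [smul_eq_mul, map_add, map_mul]
    ring

/-! ### Lemma 1 -/

set_option maxHeartbeats 800000 in

/-- **Nesterenko's Lemma 1** ([Nes3]; Zhu App. 3 Lemma 1): for `q ≠ j` and every `k`,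
`∂ρₖ/∂u_{pq} = ρ_q · ∂ρₖ/∂u_{pj}` in `𝕃₀`. (For `q = j` the identity is trivial, `ρⱼ = 1`.)
[cite: NesterenkoPhilippon2001, Ch. 10 Lemma 3.1 (p. 153), proof in [Nes3] Lemma 1] -/
theorem dL_rho_eq (p : Fin 𝒢.s) {q : Fin (m + 1)} (hq : q ≠ 𝒢.j) (k : Fin (m + 1)) :
    𝒢.dL (p, q) (𝒢.rhoL0 k) = 𝒢.rhoL0 q * 𝒢.dL (p, 𝒢.j) (𝒢.rhoL0 k) := by
  -- the derivation `E = ι ∘ ∂̃_{pq} − ρ_q (ι ∘ ∂̃_{pj}) : 𝕃₀ → 𝕃`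
  let E : Derivation ℤ 𝒢.L0 𝒢.LL :=
    { toLinearMap := (Algebra.linearMap 𝒢.L0 𝒢.LL).toAddMonoidHom.toIntLinearMap ∘ₗ
          (𝒢.dL (p, q)).toLinearMap -
        (LinearMap.mulLeft ℤ (𝒢.rho q)) ∘ₗ
          ((Algebra.linearMap 𝒢.L0 𝒢.LL).toAddMonoidHom.toIntLinearMap ∘ₗ
            (𝒢.dL (p, 𝒢.j)).toLinearMap)
      map_one_eq_zero' := by simp
      leibniz' := fun x y => by
        simp only [LinearMap.sub_apply, LinearMap.coe_comp, Function.comp_apply,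
          AddMonoidHom.coe_toIntLinearMap, LinearMap.toAddMonoidHom_coe, Derivation.coeFn_coe,
          Derivation.leibniz, map_add, Algebra.linearMap_apply, LinearMap.mulLeft_apply,
          smul_eq_mul, Algebra.smul_def, map_mul]
        ring }
  have hE : ∀ y, E y = algebraMap 𝒢.L0 𝒢.LL (𝒢.dL (p, q) y) -
      𝒢.rho q * algebraMap 𝒢.L0 𝒢.LL (𝒢.dL (p, 𝒢.j) y) := fun y => rfl
  -- `Δ_{pq}` restricted to `𝕃₀`
  let D : Derivation ℤ 𝒢.L0 𝒢.LL := ((𝒢.Δ (p, q)).restrictScalars ℤ).compAlgebraMap 𝒢.L0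
  have hD : ∀ y, D y = 𝒢.Δ (p, q) (algebraMap 𝒢.L0 𝒢.LL y) := fun y => rfl
  have hED : E = D := by
    refine Derivation.eq_of_forall_algebraMap_eq (F := 𝒢.Kp) fun x => ?_
    rw [hE, hD, dL_algebraMap, dL_algebraMap, ← IsScalarTower.algebraMap_apply,
      ← IsScalarTower.algebraMap_apply, ← IsScalarTower.algebraMap_apply, Δ_algebraMap_Kp 𝒢 p hq]
  have h : E (𝒢.rhoL0 k) = D (𝒢.rhoL0 k) := by rw [hED]
  have h' : algebraMap 𝒢.L0 𝒢.LL (𝒢.dL (p, q) (𝒢.rhoL0 k)) -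
      𝒢.rho q * algebraMap 𝒢.L0 𝒢.LL (𝒢.dL (p, 𝒢.j) (𝒢.rhoL0 k)) = 0 := by
    rw [← hE, h, hD, algebraMap_rhoL0, Δ_rho]
  apply (algebraMap 𝒢.L0 𝒢.LL).injective
  rw [map_mul, algebraMap_rhoL0]
  exact sub_eq_zero.mp h' 

set_option maxHeartbeats 800000 in
/-- Lemma 1 for an element of `ℚ[ρ]`: `∂̃_{pq} y = ρ_q ∂̃_{pj} y` for every polynomial expression
`y = R(ρ)` with rational coefficients. [cite: NesterenkoPhilippon2001, Ch. 10 Lemma 3.1 (p. 153), via [Nes3] Lemma 1] -/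
theorem dL_aeval_rhoL0 (p : Fin 𝒢.s) {q : Fin (m + 1)} (hq : q ≠ 𝒢.j) (R : Rx m) :
    𝒢.dL (p, q) (aeval 𝒢.rhoL0 R) = 𝒢.rhoL0 q * 𝒢.dL (p, 𝒢.j) (aeval 𝒢.rhoL0 R) := by
  induction R using MvPolynomial.induction_on with
  | C a =>
    rw [aeval_C, eq_ratCast, derivation_ratCast, derivation_ratCast, mul_zero]
  | add P Q hP hQ => rw [map_add, map_add, map_add, hP, hQ, mul_add]
  | mul_X P k hP =>
    rw [map_mul, aeval_X, (𝒢.dL _).leibniz, (𝒢.dL _).leibniz, hP, dL_rho_eq 𝒢 p hq k]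
    simp only [smul_eq_mul]
    ring

end GSec

end Nesterenko

end Literature.NumberTheory.Transcendental
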